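import Literature.AnabelianGeometry.SemiGraphs.TemperedAbsolutenessCyclotomicRigidityReduction
import Literature.AnabelianGeometry.AbsoluteAnabelian.GaloisSectionsFacts

/-!
# [SemiAnbd] Thm. 6.12 ⟸ [GalSect] Thm. 4.3 BY NAME: the junction of the two typings

Mochizuki, *Semi-graphs of anabelioids*, Publ. RIMS **42** (2006) [SemiAnbd], Thm. 6.12 p. 78, and
Mochizuki, *Galois sections in absolute anabelian geometry*, Nagoya Math. J. **179** (2005) [GalSect] =
[Mzk8] of [SemiAnbd], Thm. 4.3 p. 17 (Rigidity of Cuspidal Geometric Decomposition Groups).  PROOF-ONLY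
companion (abc-iut seat f-167, tranche 167; rung LADDER-ABC:A2.C) of `TemperedAbsoluteness.lean`
(FROZEN FACT-LIST row **F-1653** `AbsolutenessOrigin.CuspidalCyclotomicRigidityHolds`) and of
`GaloisSectionsFacts.lean` (FROZEN FACT-LIST row **F-0105** `GalSect.Thm_4_3`), both imported, never edited.

`TemperedAbsolutenessCyclotomicRigidityReduction.lean` records the printed proof of Thm. 6.12 ("it is
immediate that the tempered analogue of [Mzk8], Theorem 4.3, holds", p. 78) as a reduction to a PROFINITE
rigidity clause `hrigid` stated over the `TemperedCurve` interface.  The profinite theorem itself is typed in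
the tree on the OTHER side, over `FundamentalExtension` / `CuspidalData` / `GaloisCyclotome` /
`CuspidalSynchronization`, as the predicate `GalSect.Thm_4_3 T sx sy` (F-0105; abc-iut-f-097 showed its
universal closure false and that it PINS the synchronizations, `GaloisSectionsFactsThm43Schema.lean`).  This
file supplies the JUNCTION: given data identifying the completed pair `(Π_{X_K}, Π_{Y_L})` of a
`TemperedCurve` pair with a pair of fundamental extensions carrying cuspidal data, a Galois cyclotome
identified with the tree's one cyclotome `Λ(K̄^×)`, and synchronizations that ARE the completed natural
maps `μ → I_x ↪ Π̂` — all as explicit hypotheses (equations), no new definition — the clause `hrigid` at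
`(α̂, x, y)` FOLLOWS from `GalSect.Thm_4_3 T sx sy` at the junction synchronizations
(`TemperedCurve.hatRigidity_of_galSect_thm_4_3`), hence Thm. 6.12 at the pair
(`TemperedCurve.cuspidalCyclotomicRigidity_of_galSect_thm_4_3`) and F-1653 at the certificate
(`AbsolutenessOrigin.cuspidalCyclotomicRigidityHolds_of_galSect_thm_4_3`) follow from F-0105 BY NAME plus
the junction equations and the two laws of the reduction file (`α̂` lies over an isomorphism `G_K ⥲ G_L` —
[GalSect] Prop. 1.1 (ii) / [SemiAnbd] Thm. 6.4; the cyclotome transport of `α` is `T.map` of that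
isomorphism — [GalSect] §4 p. 17 "recovered group-theoretically").
WHAT THE JUNCTION DATA ARE IN PRINT: the SAME objects read twice (`Π_{X_K}` = the profinite completion of
`Π^temp_{X_K}`, p. 69; `Î_x = closure ι_X(I_x)` = the profinite cuspidal inertia group, p. 77; the natural
`μ^∧_{ℚ/ℤ}(K̄) ⥲ I_x` of [GalSect] p. 17 = the completed `μ_Ẑ(K̄) ⥲ I_x` of [SemiAnbd] Thm. 6.12).  The tree
holds no constructor of `FundamentalExtension`/`CuspidalData` from a genuine `TemperedCurve` (finiteness of
cusps and non-conjugacy of distinct cuspidal decomposition groups are not fields of `TemperedCurve`), so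
the junction is HYPOTHETICAL data here, never constructed -- TODO-merge (abc-iut-L4-t1/t4, f-097 lineage).
HONEST FRAMING: bookkeeping between two typings of refereed prerequisite results; nothing asserted; typed
≠ proved; laws ≠ facts; no bearing on, and no side taken on, [IUTchIII] Cor. 3.12.
[cite: MochizukiSemiAnbd2006, Thm 6.12 p.78] [cite: MochizukiGalSect2005, Thm 4.3 p.17]
-/

noncomputable section

namespace Literature.AnabelianGeometry.SemiGraphs

open scoped Pointwise
open _root_.Topology
open Literature.AnabelianGeometry.EtaleTheta (cyclotome)
open Literature.AnabelianGeometry.AbsoluteAnabelian (FundamentalExtension)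
open Literature.AnabelianGeometry.AbsoluteAnabelian.GalSect (GaloisCyclotome CuspidalSynchronization
  Thm_4_3)

variable {p : ℕ} [Fact p.Prime]

namespace TemperedCurve

variable {X Y : TemperedCurve p}

/-! ### 1. The profinite rigidity clause at `(α̂, x, y)` from `GalSect.Thm_4_3` at the junction -/

/-- **`hrigid` at `(α̂, x, y)` from F-0105 BY NAME.**  Junction data (all hypotheses): `jX : Π_{X_K} ⥲ Π`,
`jY : Π_{Y_L} ⥲ Π'` onto the arithmetic groups of two fundamental extensions `E`, `F`; a Galois cyclotome
`T` with `eX : μ(G_K) ⥲ Λ(K̄^×)`, `eY : μ(G_L) ⥲ Λ(K̄^×)`; cusps `x'`, `y'` of cuspidal data `Cx`, `Cy`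
whose inertia groups ARE `jX(Î_x)`, `jY(Î_y)` (`hIx`, `hIy`); synchronizations `sx`, `sy` that ARE the
completed natural maps (`hsx`, `hsy`); for the given `α̂`: an isomorphism `α_G : G_K ⥲ G_L` under
`jY ∘ α̂ ∘ jX⁻¹` (`hαG`) with `ĉ(α̂) = eY ∘ T.map α_G ∘ eX⁻¹` (`hcHat`).  Then [GalSect] Thm. 4.3 for
`(T, sx, sy)` (`h43 : GalSect.Thm_4_3 T sx sy`) and `α̂(Î_x) = Î_y` give
`α̂ ∘ ι_X ∘ (μ → I_x) = ι_Y ∘ (μ → I_y) ∘ ĉ(α̂)`.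
[cite: MochizukiGalSect2005, Thm 4.3 p.17] [cite: MochizukiSemiAnbd2006, Thm 6.12 p.78] -/
theorem hatRigidity_of_galSect_thm_4_3 (c : CyclotomeTransport X Y)
    (cHat : (X.PiHat ≃ₜ* Y.PiHat) →
      (cyclotome (AlgebraicClosure ℚ_[p])ˣ ≃* cyclotome (AlgebraicClosure ℚ_[p])ˣ))
    {E F : FundamentalExtension.{0}} (jX : X.PiHat ≃ₜ* E.arith) (jY : Y.PiHat ≃ₜ* F.arith)
    (T : GaloisCyclotome.{0}) (eX : T.μ E.gal ≃* cyclotome (AlgebraicClosure ℚ_[p])ˣ)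
    (eY : T.μ F.gal ≃* cyclotome (AlgebraicClosure ℚ_[p])ˣ)
    {Cx : E.CuspidalData} {Cy : F.CuspidalData} {x : X.Pt} {y : Y.Pt} {x' : Cx.Cusp} {y' : Cy.Cusp}
    (hIx : Cx.Icusp x' =
      (((X.inertia x).map X.toHat.toMonoidHom).topologicalClosure).map jX.toMulEquiv.toMonoidHom)
    (hIy : Cy.Icusp y' =
      (((Y.inertia y).map Y.toHat.toMonoidHom).topologicalClosure).map jY.toMulEquiv.toMonoidHom)
    (sx : CuspidalSynchronization T E Cx x') (sy : CuspidalSynchronization T F Cy y')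
    (hsx : ∀ m : T.μ E.gal, ((sx.natIso m : Cx.Icusp x') : E.arith) =
      jX (X.toHat (c.cycloToInertiaX x (eX m))))
    (hsy : ∀ m : T.μ F.gal, ((sy.natIso m : Cy.Icusp y') : F.arith) =
      jY (Y.toHat (c.cycloToInertiaY y (eY m))))
    (h43 : Thm_4_3 T sx sy)
    (αhat : X.PiHat ≃ₜ* Y.PiHat) (αG : E.gal ≃ₜ* F.gal)
    (hαG : ∀ g : X.PiHat, F.aug (jY (αhat g)) = αG (E.aug (jX g)))
    (hcHat : ∀ m : T.μ E.gal, cHat αhat (eX m) = eY (T.map αG m))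
    (hI : (((X.inertia x).map X.toHat.toMonoidHom).topologicalClosure).map αhat.toMulEquiv.toMonoidHom =
      ((Y.inertia y).map Y.toHat.toMonoidHom).topologicalClosure) :
    ∀ ζ : cyclotome (AlgebraicClosure ℚ_[p])ˣ,
      αhat (X.toHat (c.cycloToInertiaX x ζ)) = Y.toHat (c.cycloToInertiaY y (cHat αhat ζ)) := by
  -- the isomorphism `Π ⥲ Π'` corresponding to `α̂` under the junction
  let α' : E.arith ≃ₜ* F.arith := jX.symm.trans (αhat.trans jY)
  have hα' : ∀ g : X.PiHat, α' (jX g) = jY (αhat g) := fun g => by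
    change jY (αhat (jX.symm (jX g))) = jY (αhat g)
    rw [ContinuousMulEquiv.symm_apply_apply]
  -- it lies over `α_G`
  have hcompat : ∀ g : E.arith, F.aug (α' g) = αG (E.aug g) := fun g => by
    obtain ⟨g₀, rfl⟩ : ∃ g₀ : X.PiHat, jX g₀ = g := ⟨jX.symm g, jX.apply_symm_apply g⟩
    rw [hα', hαG]
  -- it carries `I_{x'}` onto `I_{y'}`
  have hI' : (Cx.Icusp x').map α'.toMonoidHom = Cy.Icusp y' := by
    rw [hIx, hIy, ← hI, Subgroup.map_map, Subgroup.map_map]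
    congr 1
    exact MonoidHom.ext fun g => hα' g
  intro ζ
  obtain ⟨m, rfl⟩ : ∃ m : T.μ E.gal, eX m = ζ := ⟨eX.symm ζ, eX.apply_symm_apply ζ⟩
  have h := h43 α' αG hcompat hI' m
  rw [hsx, hsy, hα', ← hcHat] at h
  exact jY.injective h

/-- **What a junction synchronization forces.**  If a synchronization `sx : μ(G_K) ⥲ I_{x'}` IS the
completed natural map `m ↦ jX(ι_X((μ → I_x)(eX m)))` (`hsx`), then the typed natural map
`c.cycloToInertiaX x : Λ(K̄^×) →* Π^temp_{X_K}` is INJECTIVE — in print it is "the natural isomorphism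
`μ_Ẑ(K̄) ⥲ I_x`" ([SemiAnbd] Thm. 6.12; [GalSect] p. 17), while the record `CyclotomeTransport` only types
a homomorphism with range `I_x`; so the junction hypotheses carry this genuine-data property (honesty
note: they are not satisfiable at cyclotome data with a non-injective `cycloToInertiaX x`).
[cite: MochizukiSemiAnbd2006, Thm 6.12 p.78] -/
theorem injective_cycloToInertiaX_of_synchronization (c : CyclotomeTransport X Y)
    {E : FundamentalExtension.{0}} (jX : X.PiHat ≃ₜ* E.arith) (T : GaloisCyclotome.{0})
    (eX : T.μ E.gal ≃* cyclotome (AlgebraicClosure ℚ_[p])ˣ) {Cx : E.CuspidalData} {x : X.Pt}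
    {x' : Cx.Cusp} (sx : CuspidalSynchronization T E Cx x')
    (hsx : ∀ m : T.μ E.gal, ((sx.natIso m : Cx.Icusp x') : E.arith) =
      jX (X.toHat (c.cycloToInertiaX x (eX m)))) :
    Function.Injective (c.cycloToInertiaX x) := by
  intro ζ₁ ζ₂ h
  obtain ⟨m₁, rfl⟩ : ∃ m : T.μ E.gal, eX m = ζ₁ := ⟨eX.symm ζ₁, eX.apply_symm_apply ζ₁⟩
  obtain ⟨m₂, rfl⟩ : ∃ m : T.μ E.gal, eX m = ζ₂ := ⟨eX.symm ζ₂, eX.apply_symm_apply ζ₂⟩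
  have h' : ((sx.natIso m₁ : Cx.Icusp x') : E.arith) = ((sx.natIso m₂ : Cx.Icusp x') : E.arith) := by
    rw [hsx, hsx, h]
  rw [sx.natIso.injective (Subtype.ext h')]

/-! ### 2. Thm. 6.12 at a pair from F-0105 at a junction of the pair -/

/-- **[SemiAnbd] Thm. 6.12 at the pair `(X_K, Y_L, c)` from [GalSect] Thm. 4.3 BY NAME** through a
junction of the pair: fundamental extensions `E`, `F` with `jX`, `jY`; a Galois cyclotome `T` with `eX`,
`eY`; cuspidal data `Cx`, `Cy` with, for every rational cusp `x` of `X_K` (resp. `y` of `Y_L`), a cusp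
`πx x` with `I_{πx x} = jX(Î_x)` and a synchronization `sx x` that IS the completed natural map (resp.
`πy`, `sy`); for every `α̂`, an `α_G` under it with `ĉ(α̂) = eY ∘ T.map α_G ∘ eX⁻¹` (laws `hαG`, `hcHat`);
F-0105 at every pair of junction synchronizations (`h43`); and the compatibility law `hcompat` of the
reduction file.  Conclusion: `X.CuspidalCyclotomicRigidity Y c`.
[cite: MochizukiSemiAnbd2006, Thm 6.12 p.78] [cite: MochizukiGalSect2005, Thm 4.3 p.17] -/
theorem cuspidalCyclotomicRigidity_of_galSect_thm_4_3 (c : CyclotomeTransport X Y)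
    (cHat : (X.PiHat ≃ₜ* Y.PiHat) →
      (cyclotome (AlgebraicClosure ℚ_[p])ˣ ≃* cyclotome (AlgebraicClosure ℚ_[p])ˣ))
    {E F : FundamentalExtension.{0}} (jX : X.PiHat ≃ₜ* E.arith) (jY : Y.PiHat ≃ₜ* F.arith)
    (T : GaloisCyclotome.{0}) (eX : T.μ E.gal ≃* cyclotome (AlgebraicClosure ℚ_[p])ˣ)
    (eY : T.μ F.gal ≃* cyclotome (AlgebraicClosure ℚ_[p])ˣ)
    {Cx : E.CuspidalData} {Cy : F.CuspidalData}
    (πx : ∀ x : X.Pt, X.IsCusp x → X.IsRationalPt x → Cx.Cusp)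
    (πy : ∀ y : Y.Pt, Y.IsCusp y → Y.IsRationalPt y → Cy.Cusp)
    (hIx : ∀ (x : X.Pt) (hx : X.IsCusp x) (hxr : X.IsRationalPt x), Cx.Icusp (πx x hx hxr) =
      (((X.inertia x).map X.toHat.toMonoidHom).topologicalClosure).map jX.toMulEquiv.toMonoidHom)
    (hIy : ∀ (y : Y.Pt) (hy : Y.IsCusp y) (hyr : Y.IsRationalPt y), Cy.Icusp (πy y hy hyr) =
      (((Y.inertia y).map Y.toHat.toMonoidHom).topologicalClosure).map jY.toMulEquiv.toMonoidHom)
    (sx : ∀ (x : X.Pt) (hx : X.IsCusp x) (hxr : X.IsRationalPt x),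
      CuspidalSynchronization T E Cx (πx x hx hxr))
    (sy : ∀ (y : Y.Pt) (hy : Y.IsCusp y) (hyr : Y.IsRationalPt y),
      CuspidalSynchronization T F Cy (πy y hy hyr))
    (hsx : ∀ (x : X.Pt) (hx : X.IsCusp x) (hxr : X.IsRationalPt x) (m : T.μ E.gal),
      (((sx x hx hxr).natIso m : Cx.Icusp (πx x hx hxr)) : E.arith) =
        jX (X.toHat (c.cycloToInertiaX x (eX m))))
    (hsy : ∀ (y : Y.Pt) (hy : Y.IsCusp y) (hyr : Y.IsRationalPt y) (m : T.μ F.gal),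
      (((sy y hy hyr).natIso m : Cy.Icusp (πy y hy hyr)) : F.arith) =
        jY (Y.toHat (c.cycloToInertiaY y (eY m))))
    (h43 : ∀ (x : X.Pt) (hx : X.IsCusp x) (hxr : X.IsRationalPt x) (y : Y.Pt) (hy : Y.IsCusp y)
      (hyr : Y.IsRationalPt y), Thm_4_3 T (sx x hx hxr) (sy y hy hyr))
    (αG : (X.PiHat ≃ₜ* Y.PiHat) → (E.gal ≃ₜ* F.gal))
    (hαG : ∀ (αhat : X.PiHat ≃ₜ* Y.PiHat) (g : X.PiHat),
      F.aug (jY (αhat g)) = αG αhat (E.aug (jX g)))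
    (hcHat : ∀ (αhat : X.PiHat ≃ₜ* Y.PiHat) (m : T.μ E.gal),
      cHat αhat (eX m) = eY (T.map (αG αhat) m))
    (hcompat : ∀ (α : X.PiTemp ≃ₜ* Y.PiTemp) (αhat : X.PiHat ≃ₜ* Y.PiHat),
      (∀ g : X.PiTemp, αhat (X.toHat g) = Y.toHat (α g)) → cHat αhat = c.cycloOf α) :
    X.CuspidalCyclotomicRigidity Y c :=
  cuspidalCyclotomicRigidity_of_hat c cHat
    (fun αhat x y hx hxr hy hyr hI =>
      hatRigidity_of_galSect_thm_4_3 c cHat jX jY T eX eY (hIx x hx hxr) (hIy y hy hyr) (sx x hx hxr)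
        (sy y hy hyr) (hsx x hx hxr) (hsy y hy hyr) (h43 x hx hxr y hy hyr) αhat (αG αhat) (hαG αhat)
        (hcHat αhat) hI)
    hcompat

end TemperedCurve

/-! ### 3. F-1653 from F-0105 BY NAME at a junction of the genuine data -/

namespace AbsolutenessOrigin

variable (Ω : AbsolutenessOrigin p)

/-- **[SemiAnbd] Thm. 6.12 as printed (`CuspidalCyclotomicRigidityHolds Ω`, F-1653) from [GalSect]
Thm. 4.3 (`GalSect.Thm_4_3`, F-0105) BY NAME**, through a junction of the genuine data: for every curve
`X_K` a fundamental extension `E X` with `j X : Π_{X_K} ⥲ (E X).arith`, cuspidal data `C X` whose cusps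
`π X x` at the rational cusps `x` have inertia groups `j X (Î_x)` (`hI`), ONE Galois cyclotome `T` with
`e X : μ((E X).gal) ⥲ Λ(K̄^×)`, and synchronizations `s X x` that ARE the completed natural maps of every
genuine cyclotome datum (`hsX`, `hsY`); for every `α̂` an `α_G` under it (`hαG`) with
`ĉ(α̂) = (e Y) ∘ T.map α_G ∘ (e X)⁻¹` (`hcHat`); F-0105 at every pair of junction synchronizations of
genuine curves (`h43`); and the compatibility law `hcompat`.  All junction objects are HYPOTHETICAL data
(bound variables with equations), never constructed here.
[cite: MochizukiSemiAnbd2006, Thm 6.12 p.78] [cite: MochizukiGalSect2005, Thm 4.3 p.17] -/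
theorem cuspidalCyclotomicRigidityHolds_of_galSect_thm_4_3
    (cHat : ∀ {X Y : TemperedCurve p}, CyclotomeTransport X Y → (X.PiHat ≃ₜ* Y.PiHat) →
      (cyclotome (AlgebraicClosure ℚ_[p])ˣ ≃* cyclotome (AlgebraicClosure ℚ_[p])ˣ))
    (E : TemperedCurve p → FundamentalExtension.{0}) (j : ∀ X : TemperedCurve p, X.PiHat ≃ₜ* (E X).arith)
    (T : GaloisCyclotome.{0})
    (e : ∀ X : TemperedCurve p, T.μ (E X).gal ≃* cyclotome (AlgebraicClosure ℚ_[p])ˣ)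
    (C : ∀ X : TemperedCurve p, (E X).CuspidalData)
    (π : ∀ (X : TemperedCurve p) (x : X.Pt), X.IsCusp x → X.IsRationalPt x → (C X).Cusp)
    (hI : ∀ (X : TemperedCurve p) (x : X.Pt) (hx : X.IsCusp x) (hxr : X.IsRationalPt x),
      (C X).Icusp (π X x hx hxr) =
        (((X.inertia x).map X.toHat.toMonoidHom).topologicalClosure).map (j X).toMulEquiv.toMonoidHom)
    (s : ∀ (X : TemperedCurve p) (x : X.Pt) (hx : X.IsCusp x) (hxr : X.IsRationalPt x),
      CuspidalSynchronization T (E X) (C X) (π X x hx hxr))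
    (hsX : ∀ (X Y : TemperedCurve p) (c : CyclotomeTransport X Y), Ω.IsHyperbolicCurveOrigin X →
      Ω.IsHyperbolicCurveOrigin Y → Ω.IsCyclotomeOrigin c →
      ∀ (x : X.Pt) (hx : X.IsCusp x) (hxr : X.IsRationalPt x) (m : T.μ (E X).gal),
        (((s X x hx hxr).natIso m : (C X).Icusp (π X x hx hxr)) : (E X).arith) =
          j X (X.toHat (c.cycloToInertiaX x (e X m))))
    (hsY : ∀ (X Y : TemperedCurve p) (c : CyclotomeTransport X Y), Ω.IsHyperbolicCurveOrigin X →
      Ω.IsHyperbolicCurveOrigin Y → Ω.IsCyclotomeOrigin c →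
      ∀ (y : Y.Pt) (hy : Y.IsCusp y) (hyr : Y.IsRationalPt y) (m : T.μ (E Y).gal),
        (((s Y y hy hyr).natIso m : (C Y).Icusp (π Y y hy hyr)) : (E Y).arith) =
          j Y (Y.toHat (c.cycloToInertiaY y (e Y m))))
    (h43 : ∀ (X Y : TemperedCurve p), Ω.IsHyperbolicCurveOrigin X → Ω.IsHyperbolicCurveOrigin Y →
      ∀ (x : X.Pt) (hx : X.IsCusp x) (hxr : X.IsRationalPt x) (y : Y.Pt) (hy : Y.IsCusp y)
        (hyr : Y.IsRationalPt y), Thm_4_3 T (s X x hx hxr) (s Y y hy hyr))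
    (αG : ∀ {X Y : TemperedCurve p}, (X.PiHat ≃ₜ* Y.PiHat) → ((E X).gal ≃ₜ* (E Y).gal))
    (hαG : ∀ (X Y : TemperedCurve p), Ω.IsHyperbolicCurveOrigin X → Ω.IsHyperbolicCurveOrigin Y →
      ∀ (αhat : X.PiHat ≃ₜ* Y.PiHat) (g : X.PiHat),
        (E Y).aug (j Y (αhat g)) = αG αhat ((E X).aug (j X g)))
    (hcHat : ∀ (X Y : TemperedCurve p) (c : CyclotomeTransport X Y), Ω.IsHyperbolicCurveOrigin X →
      Ω.IsHyperbolicCurveOrigin Y → Ω.IsCyclotomeOrigin c →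
      ∀ (αhat : X.PiHat ≃ₜ* Y.PiHat) (m : T.μ (E X).gal),
        cHat c αhat (e X m) = e Y (T.map (αG αhat) m))
    (hcompat : ∀ (X Y : TemperedCurve p) (c : CyclotomeTransport X Y), Ω.IsHyperbolicCurveOrigin X →
      Ω.IsHyperbolicCurveOrigin Y → Ω.IsCyclotomeOrigin c →
      ∀ (α : X.PiTemp ≃ₜ* Y.PiTemp) (αhat : X.PiHat ≃ₜ* Y.PiHat),
        (∀ g : X.PiTemp, αhat (X.toHat g) = Y.toHat (α g)) → cHat c αhat = c.cycloOf α) :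
    Literature.AnabelianGeometry.SemiGraphs.AbsolutenessOrigin.CuspidalCyclotomicRigidityHolds Ω :=
  fun X Y c hX hY hc =>
    TemperedCurve.cuspidalCyclotomicRigidity_of_galSect_thm_4_3 c (cHat c) (j X) (j Y) T (e X) (e Y)
      (π X) (π Y) (hI X) (hI Y) (s X) (s Y) (hsX X Y c hX hY hc) (hsY X Y c hX hY hc)
      (h43 X Y hX hY) αG (hαG X Y hX hY) (hcHat X Y c hX hY hc) (hcompat X Y c hX hY hc)

end AbsolutenessOrigin

end Literature.AnabelianGeometry.SemiGraphs

end
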